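import Summits.CriticalPhenomena.PercolationContinuityZ3.Theorems.Transplant.SkelNegBParamsFaceA
import Summits.CriticalPhenomena.PercolationContinuityZ3.Theorems.Transplant.SkelNegBParamsRootValsA
import HarnessLib

/-!
# N1 params, (ζ′) chain (`A := NegB.Aof κ = 800·Kq`), part FaceBandA: THE CONTACT BAND FITS THE TRANSVERSE HABITAT AT THE (ζ′) RECORD — the A-twin of
# part FaceBand (stmt-g15): `kFF₂ (prFA) fcellsA Rl I ≤ 2r + 5Rl + 15`, hence `kFF₂ + 6·u_JA + 9 ≤ 5·r_J` (hp-8's FX5/FX6 floor `kE + 6κ⊥ + k₀ + 6 ≤ 5r⊥`,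
# κ⊥ := u_JA = s_J the (ζ′) stride in cells, k₀ ≤ 3) and `2·kFF₂ + 2·u_JA + 7 ≤ 5·r_J` ((L-F3)), at `g := gT`, every `Rl ≤ RA′`
# (p1 lineage's Face*A batch, p3-g11 02:53:30Z; naming rule stmt-g16 02:36:08Z (2)).  Under (ζ′) `r_J = K·s_J = 40·Kq·u_JA` (`KS.units_eqA`), so the
# stride unit is `u_JA` itself (today's `r_J/40`): the two floors are stated with `KS.u₀A/u₁A` explicitly.
builds on p205010 (kernel theorem, internal audit signed; external expert review pending) — nothing in this file uses p205010; NOTHING is claimed about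
the node `SamePDropOfSkeletonNeg₁` (OPEN; closure of record = the L pair, p3-g11 03:25:24Z).
Lane `prim-bschramm-*`, seat `prim-bschramm-p1` (gen 13; for the stmt params column); helper file (`--supports stmt-CriticalPhenomena-4575 --as helper`).
* **`kFF₂_le_linA`**, `uA_oth_facts`, **`hkE_RA`**.
[cite: KozmaNitzan2024, §4 Lemma 10 Step IV (pp. 20–21); Lemma 12 (pp. 23–25)] [cite: MartineauTassion2017, §4.3]
-/

noncomputable section

open scoped Classical

namespace Summit.CriticalPhenomena.PercolationContinuityZ3.Theorems.Transplant

namespace PlanarSkeletonNeg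

namespace NegB

open Literature.Probability.Percolation Literature.Probability.LatticeModels SimpleGraph
open Literature.Probability.Percolation.KozmaNitzan.Cells (oth)
open SkelConc (Consts)
open Skelφ.StepI (DataN)
open Neg

section Band

variable (κ : Consts) {V : Type} [DecidableEq V] [Countable V] {G : SimpleGraph V} [G.LocallyFinite] (Φ : PlanarSkeletonNeg G) (t : V)
  (p : unitInterval) (D : DataN V) (f mk : ℕ) (gx : Neg.FSlot)

/-- **The contact band half-width is linear in the cell radius**: `kFF₂ (prFA) fcellsA Rl I ≤ 2·r_(oth I) + 5·Rl + 15` at `g := gT` (any `Rl`, both axes).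
[cite: KozmaNitzan2024, §4 Lemma 10 Step IV] -/
theorem kFF₂_le_linA (hN : EqNumL κ Φ t p D (KS.gT mk gx κ Φ t p D) f) (hκ : (hL κ Φ t p D (KS.gT mk gx κ Φ t p D) f).natAbs ≤ 10 * nL κ Φ t p D (KS.gT mk gx κ Φ t p D) f)
    (Rl : ℕ) (I : Fin 2) :
    (prFA κ Φ t p D (KS.gT mk gx κ Φ t p D) f).kFF₂ (fcellsA κ Φ t p D (KS.gT mk gx κ Φ t p D) f) Rl I ≤
      2 * ((fcellsA κ Φ t p D (KS.gT mk gx κ Φ t p D) f).r (oth I) : ℤ) + 5 * Rl + 15 := by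
  set pr := prFA κ Φ t p D (KS.gT mk gx κ Φ t p D) f
  set P := fcellsA κ Φ t p D (KS.gT mk gx κ Φ t p D) f
  have hDpos : 0 < pr.D := by
    obtain ⟨hn1, hℓ1⟩ := one_le_of_eqNumL κ Φ t p D (KS.gT mk gx κ Φ t p D) f hN
    have e : pr.D = Skelφ.NegPrm.DofA (Aof κ) (nL κ Φ t p D (KS.gT mk gx κ Φ t p D) f) (hL κ Φ t p D (KS.gT mk gx κ Φ t p D) f)
        (ℓL κ Φ t p D (KS.gT mk gx κ Φ t p D) f) (vL κ Φ t p D (KS.gT mk gx κ Φ t p D) f) :=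
      (prFA_fields κ Φ t p D (KS.gT mk gx κ Φ t p D) f).2.2.2.2.2.2.2
    rw [e]; exact Skelφ.NegPrm.DofA_pos (Aof_pos κ).2 hn1 hℓ1 _ _
  obtain ⟨hc₀, hc₁⟩ := prFA_c_pos κ Φ t p D (KS.gT mk gx κ Φ t p D) f
  have hDd := prFA_D κ Φ t p D (KS.gT mk gx κ Φ t p D) f
  have hx : 0 < pr.rdK I (pr.bOf I) := rdK_pos_RA κ Φ t p D _ f hN I
  have hM : 0 < pr.Mabs := pr.Mabs_pos hc₀ hc₁ hDd hDpos
  have hy : pr.rdN I (pr.bOf I) ≤ pr.rdK I (pr.bOf I) * 3 := rdN_le_three_rdKA κ Φ t p D _ f hN I (eleven_le_s_TA κ Φ t p D f mk gx hN hκ I)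
  have hM2 : pr.Mabs ≤ 2 * pr.rdK I (pr.bOf I) * pr.D := Mabs_le_two_rdK_DA κ Φ t p D _ f hN I
  set aw := pr.awF₂ P (I, true) with haw
  have haw' : pr.Mabs * aw ≤ pr.awNum P (I, true) + pr.Mabs - 1 := by
    rw [haw]; unfold Skelφ.FinePrm.awF₂; exact Int.mul_ediv_self_le hM.ne'
  rw [awNum_eqA] at haw'
  set x := pr.rdK I (pr.bOf I)
  set y := pr.rdN I (pr.bOf I)
  set r := (P.r (oth I) : ℤ)
  have hxD : 0 < x * pr.D := mul_pos hx hDpos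
  set q := pr.kFF₂ P Rl I with hq
  have hq' : x * pr.D * q ≤ pr.Mabs * (aw + Rl + 1) + y * (Rl + 2) * pr.D + x * pr.D - 1 := by
    rw [hq]; unfold Skelφ.FinePrm.kFF₂; exact Int.mul_ediv_self_le hxD.ne'
  have hR0 : (0 : ℤ) ≤ Rl := Nat.cast_nonneg _
  have hr0 : (0 : ℤ) ≤ r := Nat.cast_nonneg _
  have hyR : y * ((Rl : ℤ) + 2) * pr.D ≤ x * 3 * ((Rl : ℤ) + 2) * pr.D := by
    have : 0 ≤ ((Rl : ℤ) + 2) * pr.D := mul_nonneg (by linarith) hDpos.le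
    nlinarith
  have hMR : pr.Mabs * ((Rl : ℤ) + 1) ≤ 2 * x * pr.D * ((Rl : ℤ) + 1) := mul_le_mul_of_nonneg_right hM2 (by linarith)
  have hyD : y * pr.D ≤ 3 * x * pr.D := by nlinarith
  -- `xD·q ≤ M·aw + M(Rl+1) + y(Rl+2)D + xD − 1 ≤ (x(2r+1)+y)D + M − 1 + … ≤ xD·(2r + 5Rl + 15) − 1`
  have hlin : x * pr.D * q ≤ x * pr.D * (2 * r + 5 * Rl + 15) - 1 := by
    have e1 : pr.Mabs * (aw + Rl + 1) = pr.Mabs * aw + pr.Mabs * ((Rl : ℤ) + 1) := by ring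
    nlinarith
  have hle : x * pr.D * q < x * pr.D * (2 * r + 5 * Rl + 15 + 1) := by nlinarith
  have := lt_of_mul_lt_mul_left hle hxD.le
  linarith

/-- The (ζ′) stride unit of the transverse axis `J := oth I`: `r_J = 40·Kq·u_JA`, `6·RA′ + 11 ≤ u_JA` at `g := gT` (so `40·u_JA ≤ r_J`). [folklore] -/
theorem uA_oth_facts (hN : EqNumL κ Φ t p D (KS.gT mk gx κ Φ t p D) f) (hκ : (hL κ Φ t p D (KS.gT mk gx κ Φ t p D) f).natAbs ≤ 10 * nL κ Φ t p D (KS.gT mk gx κ Φ t p D) f)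
    (I : Fin 2) :
    ((fcellsA κ Φ t p D (KS.gT mk gx κ Φ t p D) f).r (oth I) : ℤ) =
        40 * (Neg.Kq κ : ℤ) * (if oth I = 0 then KS.u₀A κ Φ t p D (KS.gT mk gx κ Φ t p D) f else KS.u₁A κ Φ t p D (KS.gT mk gx κ Φ t p D) f) ∧
      6 * (KS.RA' κ Φ t p D mk : ℤ) + 11 ≤ (if oth I = 0 then KS.u₀A κ Φ t p D (KS.gT mk gx κ Φ t p D) f else KS.u₁A κ Φ t p D (KS.gT mk gx κ Φ t p D) f) ∧
      40 * (if oth I = 0 then KS.u₀A κ Φ t p D (KS.gT mk gx κ Φ t p D) f else KS.u₁A κ Φ t p D (KS.gT mk gx κ Φ t p D) f) ≤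
        ((fcellsA κ Φ t p D (KS.gT mk gx κ Φ t p D) f).r (oth I) : ℤ) := by
  obtain ⟨-, -, hr0, hr1, -, -, hu0, hu1⟩ := KS.units_eqA κ Φ t p D (KS.gT mk gx κ Φ t p D) f
  obtain ⟨g0, g1⟩ := KS.cells_geTA' κ Φ t p D mk gx f hN hκ
  have hKq : (1 : ℤ) ≤ Neg.Kq κ := by exact_mod_cast Neg.one_le_Kq κ
  obtain rfl | rfl : I = 0 ∨ I = 1 := by fin_cases I <;> simp
  · rw [show oth (0 : Fin 2) = 1 from rfl]
    simp only [show ((1 : Fin 2) = 0) = False from propext ⟨fun h => absurd h (by decide), False.elim⟩, if_false]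
    refine ⟨hr1, ?_, ?_⟩
    · unfold KS.u₁A; linarith
    · rw [hr1]; nlinarith
  · rw [show oth (1 : Fin 2) = 0 from rfl]
    simp only [if_true]
    refine ⟨hr0, ?_, ?_⟩
    · unfold KS.u₀A; linarith
    · rw [hr0]; nlinarith

/-- **THE TWO HABITAT FLOORS OF THE CONTACT BAND AT THE (ζ′) RECORD** at `g := gT`, every `Rl ≤ RA′`, both axes (`u_JA = s_J` the stride in cells):
`kFF₂ + 6·u_JA + 9 ≤ 5·r_J` (hp-8's FX5/FX6 floor with `k₀ ≤ 3`) and `2·kFF₂ + 2·u_JA + 7 ≤ 5·r_J` (the tangential reach, (L-F3)). [cite: KozmaNitzan2024, §4 Lemma 12 (pp. 23–25)] -/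
theorem hkE_RA (hN : EqNumL κ Φ t p D (KS.gT mk gx κ Φ t p D) f) (hκ : (hL κ Φ t p D (KS.gT mk gx κ Φ t p D) f).natAbs ≤ 10 * nL κ Φ t p D (KS.gT mk gx κ Φ t p D) f)
    {Rl : ℕ} (hRl : Rl ≤ KS.RA' κ Φ t p D mk) (I : Fin 2) :
    (prFA κ Φ t p D (KS.gT mk gx κ Φ t p D) f).kFF₂ (fcellsA κ Φ t p D (KS.gT mk gx κ Φ t p D) f) Rl I +
          6 * (if oth I = 0 then KS.u₀A κ Φ t p D (KS.gT mk gx κ Φ t p D) f else KS.u₁A κ Φ t p D (KS.gT mk gx κ Φ t p D) f) + 9 ≤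
        5 * ((fcellsA κ Φ t p D (KS.gT mk gx κ Φ t p D) f).r (oth I) : ℤ) ∧
      2 * (prFA κ Φ t p D (KS.gT mk gx κ Φ t p D) f).kFF₂ (fcellsA κ Φ t p D (KS.gT mk gx κ Φ t p D) f) Rl I +
          2 * (if oth I = 0 then KS.u₀A κ Φ t p D (KS.gT mk gx κ Φ t p D) f else KS.u₁A κ Φ t p D (KS.gT mk gx κ Φ t p D) f) + 7 ≤
        5 * ((fcellsA κ Φ t p D (KS.gT mk gx κ Φ t p D) f).r (oth I) : ℤ) := by
  have hq := kFF₂_le_linA κ Φ t p D f mk gx hN hκ Rl I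
  obtain ⟨-, hu, hru⟩ := uA_oth_facts κ Φ t p D f mk gx hN hκ I
  have hRl' : (Rl : ℤ) ≤ KS.RA' κ Φ t p D mk := by exact_mod_cast hRl
  have hR0 : (0 : ℤ) ≤ (Rl : ℤ) := Nat.cast_nonneg _
  set q := (prFA κ Φ t p D (KS.gT mk gx κ Φ t p D) f).kFF₂ (fcellsA κ Φ t p D (KS.gT mk gx κ Φ t p D) f) Rl I
  set u := (if oth I = 0 then KS.u₀A κ Φ t p D (KS.gT mk gx κ Φ t p D) f else KS.u₁A κ Φ t p D (KS.gT mk gx κ Φ t p D) f)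
  set r := ((fcellsA κ Φ t p D (KS.gT mk gx κ Φ t p D) f).r (oth I) : ℤ)
  constructor <;> linarith

end Band

end NegB

end PlanarSkeletonNeg

end Summit.CriticalPhenomena.PercolationContinuityZ3.Theorems.Transplant

end
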